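/-
Copyright (c) 2026. All rights reserved.
Released under Apache 2.0 license as described in the file LICENSE.
-/
import Literature.Computability.QuantumComplexity.RevWidthUnaryFP
import Literature.Computability.QuantumComplexity.GRBlockWordCapFP
import Literature.Computability.QuantumComplexity.QFTKitSizesFP
import Literature.Computability.Complexity.Williams2014StageAFP

/-!
# The table sampler's window length `wlen` in UNARY on codes

`GRTableMach.wlen τ ℓ np = sup_{j<ℓ} (width (cosE τ) (cosM τ) (j + np + |1ʲ 0 1^{j+np+1}|) − (j + np))` — the third
unary size of `GRBlockWordCosFP.blockAN_cos_codeFP_of` — from `ℓ, np` in unary: per level the width in unary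
(`RevWidthUnaryFP.width_unary_of` at the clean-block input length `GRBlockWordCapFP.suffixN_codeFP_of`), unary
truncated subtraction (`MachineA.unSub`), the list over `range ℓ` with the binary enumeration index recoded to
the capped unary index, and the maximum in unary (`QFTKitSizesFP.ulmax`), with `wlen = lmax` of that list
(`wlen_eq_lmax`). [cite: Regev2009, Lemma 3.14 (proof)] [cite: AroraBarak2009, §1.3 and §6.2 (proof of Thm. 6.15)]

HONEST FRAMING: the VALUE is a THEOREM (kernel-checked lemmas of a KNOWN reduction, Regev 2009) — NOT summit progress.
-/

noncomputable section

namespace Literature.Computability.QuantumComplexity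

open _root_.Computability Cryptography Complexity Complexity.CodeFP SLP RevDesc AJLCore RevSim RevClean

/-- The maximum is below any common bound. [folklore] -/
private theorem lmax_le_of {l : List ℕ} {b : ℕ} (h : ∀ a ∈ l, a ≤ b) : BlockKit.lmax l ≤ b := by
  induction l with
  | nil => exact Nat.zero_le _
  | cons x l ih =>
    simp only [BlockKit.lmax, List.foldr_cons] at *
    exact max_le (h x (by simp)) (ih fun a ha => h a (by simp [ha]))

namespace GRTableMach

/-- **The window length is the maximum over the level list.** [cite: Regev2009, Lemma 3.14 (proof)] -/
theorem wlen_eq_lmax (τ : LevelCode) (ℓ np : ℕ) : wlen τ ℓ np = BlockKit.lmax ((List.range ℓ).map fun j =>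
    width (cosE τ) (cosM τ) (j + np + (GRCosineMach.v np j).length) - (j + np)) := by
  refine le_antisymm (Finset.sup_le fun j _ => BlockKit.le_lmax ?_) (lmax_le_of fun a ha => ?_)
  · exact List.mem_map.2 ⟨j, List.mem_range.2 j.2, rfl⟩
  · obtain ⟨j, hj, rfl⟩ := List.mem_map.1 ha
    exact Finset.le_sup (f := fun j : Fin ℓ => width (cosE τ) (cosM τ) (j + np + (GRCosineMach.v np j).length) - (j + np))
      (Finset.mem_univ ⟨j, List.mem_range.1 hj⟩)

/-- **The window length `wlen τ ℓ np` in unary on codes**, from `ℓ, np` in unary. [cite: Regev2009, Lemma 3.14 (proof)]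
[cite: AroraBarak2009, §1.3 and §6.2 (proof of Thm. 6.15)] -/
theorem wlen_codeFP_of (τ : LevelCode) {σ : Type} {eσ : σ → List Bool} {ℓ np : σ → ℕ}
    (hℓ : CodeFP eσ unE ℓ) (hnp : CodeFP eσ unE np) : CodeFP eσ unE (fun c => wlen τ (ℓ c) (np c)) := by
  -- per level, over `(c, j)` with `j` in unary
  have hW : CodeFP (pairE eσ unE) unE (fun q =>
      width (cosE τ) (cosM τ) (q.2 + np q.1 + (GRCosineMach.v (np q.1) q.2).length) - (q.2 + np q.1)) :=
    MachineA.unSub.comp ((RevClean.width_unary_of (cosE τ) (cosM τ) (GRStage.suffixN_codeFP_of hnp)).pair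
      (BP.uadd (snd _ _) (hnp.comp (fst _ _))))
  -- recode the binary enumeration index to the capped unary index
  have J : CodeFP (pairE eσ natE) unE (fun q => min q.2 (ℓ q.1)) := (unOfNatMin.comp ((hℓ.comp (fst _ _)).pair (snd _ _)) :)
  have hW' : CodeFP (pairE eσ natE) unE (fun q => width (cosE τ) (cosM τ) (min q.2 (ℓ q.1) + np q.1 +
      (GRCosineMach.v (np q.1) (min q.2 (ℓ q.1))).length) - (min q.2 (ℓ q.1) + np q.1)) := (hW.comp ((fst _ _).pair J) :)
  have hL : CodeFP eσ (rawE unE) (fun c => (List.range (ℓ c)).map fun j => width (cosE τ) (cosM τ) (min j (ℓ c) + np c +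
      (GRCosineMach.v (np c) (min j (ℓ c))).length) - (min j (ℓ c) + np c)) :=
    ((map hW').comp ((CodeFP.id _).pair (urange.comp hℓ))).congr fun _ => rfl
  exact (ulmax.comp hL).congr fun c => by
    show BlockKit.lmax _ = wlen τ (ℓ c) (np c)
    rw [wlen_eq_lmax]
    congr 1
    exact List.map_congr_left fun j hj => by rw [Nat.min_eq_left (List.mem_range.1 hj).le]

end GRTableMach

end Literature.Computability.QuantumComplexity

end
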